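import Literature.Analysis.FluidPDE.NSCriticalClosureTao2021

/-!
# Route SubcubicESS — the velocity ESS bound at viscosity `ν` (helper for items
stmt-NavierStokesRegularity-10676 `UniformESSClosure` and stmt-NavierStokesRegularity-10675 `EnergyBridge`)

The route `SubcubicESS` quantifies over an abstract size function `F : ℝ → ℝ` in the velocity
clause of Tao's quantitative Escauriaza–Seregin–Šverák theorem (Tao 2021, Thm. 1.2, `ν = 1`):
every classical solution of the unforced Navier–Stokes system with `ν = 1` on `[0, T] × ℝ³` in
Tao's class (all `‖∇ⁿu(t)‖_{L²}` bounded on `[0, T]`) with `‖u(t)‖₃ ≤ A` on `[0, T]`, `A ≥ 2`,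
obeys `|u(t, x)| ≤ F(A) t^{-1/2}`. This file transports such a bound to viscosity `ν > 0` by the
rescaling `w(s, x) = ν⁻¹u(s/ν, x)`, `q(s, x) = ν⁻²p(s/ν, x)` (Tao 2013, footnote 3;
`IsClassicalNSSolutionOn.viscosityRescale_zero`): `|u(t, x)| ≤ ν F(max(2, ν⁻¹N)) (νt)^{-1/2}`
whenever `‖u(t)‖₃ ≤ N` on `[0, T]`. It is `Literature.Analysis.FluidPDE.norm_le_of_tao_quantitative`
(`NSCriticalClosureTao2021.lean`) with the triple exponential `taoTripleExp C` replaced by `F` and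
only the velocity clause read; Tao's class is written out definitionally
(`IsClassicalNSSolutionOn (Icc 0 T) 1 0 u p ∧ ∀ n, ∃ C, ∀ t ∈ Icc 0 T, ‖∇ⁿu(t)‖_{L²} ≤ C`, which
is `IsHkClassicalSolutionOn (Icc 0 T) u p` by `Iff.rfl`), as in the route file.

## References

* T. Tao, *Quantitative bounds for critically bounded solutions to the Navier–Stokes equations*,
  Proc. Sympos. Pure Math. 104 (2021) = arXiv:1908.04958, Thm. 1.2. [Tao2021QuantitativeNS]
* T. Tao, Anal. PDE 6 (2013) = arXiv:1108.1165, footnote 3 (viscosity normalisation). [Tao2011]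
-/

noncomputable section

open Literature.Analysis.FluidPDE MeasureTheory Set Function Filter Topology
open scoped ENNReal NNReal

namespace Summit.NavierStokesRegularity.NavierStokesRegularity.Theorems

/-! ### Step 1: the velocity bound at viscosity `ν` -/

/-- **A uniform velocity ESS bound transported to viscosity `ν`** (the viscosity rescaling
`w(s, x) = ν⁻¹ u(s/ν, x)` of Tao 2013, footnote 3, applied to an abstract size function `F`).
Suppose every classical solution with `ν = 1` on `[0, T] × ℝ³` in Tao's class with
`‖u(t)‖₃ ≤ A` on `[0, T]`, `A ≥ 2`, obeys `|u(t, x)| ≤ F(A) t^{-1/2}` for `0 < t ≤ T`. If `(u, p)`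
is a classical solution of the unforced system with viscosity `ν > 0` on `[0, T] × ℝ³` with
`sup_t ‖∇ⁿu(t)‖_{L²} < ∞` for every `n` and `‖u(t)‖₃ ≤ N` on `[0, T]`, then for `0 < t ≤ T`,
`|u(t, x)| ≤ ν · F(A) · (νt)^{-1/2}` with `A = max(2, ν⁻¹N)`: the rescaled pair is a classical
solution with viscosity `1` on `[0, νT]` (`IsClassicalNSSolutionOn.viscosityRescale_zero`) in
Tao's class (`‖∇ⁿw(s)‖₂ = ν⁻¹‖∇ⁿu(s/ν)‖₂`), with `‖w(s)‖₃ = ν⁻¹‖u(s/ν)‖₃ ≤ A`, and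
`u(t, x) = ν w(νt, x)`. Copy of `Literature.Analysis.FluidPDE.norm_le_of_tao_quantitative` with
`taoTripleExp C ↦ F`. -/
theorem subcubicESS_norm_le_of_velocity_bound {F : ℝ → ℝ}
    (hTao : ∀ (T A : ℝ) (u : ℝ → EuclideanSpace ℝ (Fin 3) → EuclideanSpace ℝ (Fin 3))
      (p : ℝ → EuclideanSpace ℝ (Fin 3) → ℝ),
      (IsClassicalNSSolutionOn (Icc 0 T) 1 0 u p ∧
        ∀ n : ℕ, ∃ C : ℝ≥0, ∀ t ∈ Icc 0 T, eLpNorm (iteratedFDeriv ℝ n (u t)) 2 volume ≤ C) →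
      (∀ t ∈ Icc 0 T, eLpNorm (u t) 3 volume ≤ ENNReal.ofReal A) → 2 ≤ A →
      ∀ t ∈ Ioc 0 T, ∀ x : EuclideanSpace ℝ (Fin 3), ‖u t x‖ ≤ F A * t ^ (-(1 / 2 : ℝ)))
    {ν T N : ℝ} (hν : 0 < ν) (hT : 0 < T)
    {u : ℝ → EuclideanSpace ℝ (Fin 3) → EuclideanSpace ℝ (Fin 3)}
    {p : ℝ → EuclideanSpace ℝ (Fin 3) → ℝ} (hsol : IsClassicalNSSolutionOn (Icc 0 T) ν 0 u p)
    (hHk : HasBoundedSobolevNormsOn (Icc 0 T) u)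
    (hN : ∀ t ∈ Icc 0 T, eLpNorm (u t) 3 volume ≤ ENNReal.ofReal N) :
    ∀ t ∈ Ioc 0 T, ∀ x : EuclideanSpace ℝ (Fin 3),
      ‖u t x‖ ≤ ν * F (max 2 (ν⁻¹ * N)) * (ν * t) ^ (-(1 / 2 : ℝ)) := by
  set w : ℝ → EuclideanSpace ℝ (Fin 3) → EuclideanSpace ℝ (Fin 3) := timeRescale ν⁻¹ ν⁻¹ u
    with hw
  set q : ℝ → EuclideanSpace ℝ (Fin 3) → ℝ := timeRescale ν⁻¹ (ν⁻¹ ^ 2) p with hq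
  have hν' : 0 ≤ ν⁻¹ := inv_nonneg.2 hν.le
  -- the rescaled pair is classical with viscosity `1` on `[0, νT]`
  have hwsol : IsClassicalNSSolutionOn (Icc 0 (ν * T)) 1 0 w q :=
    hsol.viscosityRescale_zero hν hT
  -- Tao's class: Sobolev bounds of the slices
  have hwHk : IsClassicalNSSolutionOn (Icc 0 (ν * T)) 1 0 w q ∧
      ∀ n : ℕ, ∃ C : ℝ≥0, ∀ s ∈ Icc 0 (ν * T),
        eLpNorm (iteratedFDeriv ℝ n (w s)) 2 volume ≤ C := by
    refine ⟨hwsol, fun n => ?_⟩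
    obtain ⟨Cn, hCn⟩ := hHk n
    refine ⟨‖ν⁻¹‖₊ * max 1 Cn, fun s hs => ?_⟩
    have ht : ν⁻¹ * s ∈ Icc 0 T := mapsTo_inv_mul_Icc hν hs
    have hslice : w s = fun x => ν⁻¹ • u (ν⁻¹ * s) x := timeRescale_slice _ _ _ _
    have hderiv : iteratedFDeriv ℝ n (w s) = fun x => ν⁻¹ • iteratedFDeriv ℝ n (u (ν⁻¹ * s)) x := by
      funext x
      rw [hslice]
      exact iteratedFDeriv_const_smul_apply'
        (((hsol.contDiff_velocity ht).of_le (by exact_mod_cast le_top)).contDiffAt)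
    rw [hderiv]
    calc eLpNorm (fun x => ν⁻¹ • iteratedFDeriv ℝ n (u (ν⁻¹ * s)) x) 2 volume
        = ‖ν⁻¹‖ₑ * eLpNorm (iteratedFDeriv ℝ n (u (ν⁻¹ * s))) 2 volume :=
          eLpNorm_const_smul ν⁻¹ (iteratedFDeriv ℝ n (u (ν⁻¹ * s))) 2 volume
      _ ≤ ‖ν⁻¹‖ₑ * max 1 (Cn : ℝ≥0∞) := by
          gcongr
          exact eLpNorm_two_le_max_of_lintegral_sq_le (hCn _ ht)
      _ = ((‖ν⁻¹‖₊ * max 1 Cn : ℝ≥0) : ℝ≥0∞) := by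
          rw [ENNReal.coe_mul, ENNReal.coe_max, ENNReal.coe_one, enorm_eq_nnnorm]
  -- the critical norm of the slices
  set A : ℝ := max 2 (ν⁻¹ * N) with hA
  have hwL3 : ∀ s ∈ Icc 0 (ν * T), eLpNorm (w s) 3 volume ≤ ENNReal.ofReal A := by
    intro s hs
    have ht : ν⁻¹ * s ∈ Icc 0 T := mapsTo_inv_mul_Icc hν hs
    have hslice : w s = fun x => ν⁻¹ • u (ν⁻¹ * s) x := timeRescale_slice _ _ _ _
    rw [hslice]
    calc eLpNorm (fun x => ν⁻¹ • u (ν⁻¹ * s) x) 3 volume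
        = ‖ν⁻¹‖ₑ * eLpNorm (u (ν⁻¹ * s)) 3 volume := eLpNorm_const_smul ν⁻¹ (u (ν⁻¹ * s)) 3 volume
      _ ≤ ENNReal.ofReal ν⁻¹ * ENNReal.ofReal N := by
          rw [Real.enorm_eq_ofReal hν']
          gcongr
          exact hN _ ht
      _ = ENNReal.ofReal (ν⁻¹ * N) := (ENNReal.ofReal_mul hν').symm
      _ ≤ ENNReal.ofReal A := ENNReal.ofReal_le_ofReal (le_max_right _ _)
  have hbound := hTao (ν * T) A w q hwHk hwL3 (le_max_left _ _)
  -- read off the bound at `s = νt`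
  intro t ht x
  have hs : ν * t ∈ Ioc 0 (ν * T) := ⟨mul_pos hν ht.1, mul_le_mul_of_nonneg_left ht.2 hν.le⟩
  have h1 := hbound (ν * t) hs x
  have hval : w (ν * t) x = ν⁻¹ • u t x := by
    rw [hw, timeRescale_apply, ← mul_assoc, inv_mul_cancel₀ hν.ne', one_mul]
  rw [hval, norm_smul, Real.norm_of_nonneg hν', inv_mul_le_iff₀ hν] at h1
  calc ‖u t x‖ ≤ ν * (F A * (ν * t) ^ (-(1 / 2 : ℝ))) := h1
    _ = ν * F A * (ν * t) ^ (-(1 / 2 : ℝ)) := (mul_assoc _ _ _).symm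


end Summit.NavierStokesRegularity.NavierStokesRegularity.Theorems

end
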